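import Literature.AlgebraicGeometry.ModuliOfAbelianVarieties.SiegelModuliInterpretation
import Literature.AlgebraicGeometry.AbelianSchemes.AbelianSchemeFibreHom
import Literature.Geometry.ComplexAnalytic.RelativeExponentialUniformisation
import Literature.Geometry.Kaehler.ComplexTorusHomLift
import HarnessLib

/-!
# The endomorphism of a chart recipe READS the integral matrix through the chart's marking of the fibre
# ([BirkenhakeLange2004] §1.2 Prop. 1.2.1 (analytic vs rational representation); [MumfordFogartyKirwan1994] Ch. 6 §2 Def. 6.3; [Milne2005ShimuraVarieties] Thm. 6.11)

Topic `Literature/AlgebraicGeometry/ModuliOfAbelianVarieties`; namespace `Literature.AlgebraicGeometry.ModuliOfAbelianVarieties.SiegelAdelicMarking`.  THEOREMS ONLY (no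
definition, no named fact, no instance, no notation, no `sorry`).  Cell `hodgecm-mathlib` (D-0151), FLOOR 0, P6 «MOD» (crux hLiu418 = stmt-HodgeConjecture-24832,
`--supports`), organ **RD-P «PIECE-LEVEL READING»** of the E6 closer of `Cruxes/HLiu418/Lines/F0_P6a_PELWitnessE.lean` (socket Σ-AN `ReadsCReading`, census v2 row RD-4;
E6 heir A-p06 (g33)): ★ COV-6 `exists_isMonHom_of_piece_readings` (A-p04 (g24)) delivers, per piece, an endomorphism `Y` with the CHART RECIPE
`φA (ex (t, C z)) = φA (ex (t, z)) ≫ Y` and the (ADM) marking `m` of the fibre at `φT t` whose torus map IS the chart fibre map; this file turns the two into the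
`Reads`-clause of the closer at that fibre — `Y_{φT t} (m τ) = m (ρ(A) τ)` — so that RD-4 only has to move a `Reads`-clause along ★ RD-T3 ∕ ★ ASM.  HC_CM is proved
only modulo the printed citations (2 remaining named inputs hLiu418 24832, h413 24833) until rung 0 closes; this file is generic and changes no count.

THE MATHEMATICS.  `B → T` an abelian scheme over a complex base, `s` a complex point, `m` a marking of the fibre `B_s` whose torus map, read in the total space,
is a chart fibre map `e : ℂ^g → MA` (`fibrePointToLeft s (m (π z)) = φA (e z)`), `Y : B → B` a homomorphism inducing the recipe `φA (e (C z)) = φA (e z) ≫ Y`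
for a map `C` which is the avatar of an integral `A` in the marking's coordinates (`C (Ψ w) = Ψ (A_ℝ w)`).  Then the fibre homomorphism `Y_s` READS `A`
through `m`: `Y_s (m τ) = m (ρ(A) τ)` for every `τ` in the model torus — the point of `B` under both sides is `φA (e (C z))` for `τ = π z` (★
`fibrePointToLeft_map_fibreHom`, ★ `ComplexTorus.mapMatrix_cover`, `C = realRep Ψ Ψ A`, injectivity of ★ `fibrePointToLeft`), i.e. the analytic
representation `C` and the rational representation `A` of `Y_s` in the marking ([BirkenhakeLange2004] Prop. 1.2.1).

* `map_fibreHom_toFun_eq_of_chartRecipe` — THE HEAD (the `Reads`-clause of the E6 closer at one fibre, from a chart recipe).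

## References
* [BirkenhakeLange2004] C. Birkenhake, H. Lange, *Complex Abelian Varieties*, 2nd ed. (2004), §1.2 Proposition 1.2.1 and (1.2).
* [MumfordFogartyKirwan1994] D. Mumford, J. Fogarty, F. Kirwan, *Geometric Invariant Theory*, 3rd ed. (1994), Ch. 6 §2 Definition 6.3 (p. 120).
* [Milne2005ShimuraVarieties] J. S. Milne, *Introduction to Shimura Varieties* (2005; rev. 2017), §6 Thm. 6.11 pp. 74–75.
-/

set_option autoImplicit false

noncomputable section

open CategoryTheory CategoryTheory.Limits AlgebraicGeometry Matrix

namespace Literature.AlgebraicGeometry.ModuliOfAbelianVarieties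

open Literature.AlgebraicGeometry.Motives (SchemeOver ComplexPoints AlgPoints AbelianVariety)
open Literature.AlgebraicGeometry.AbelianSchemes (AbelianSchemeOver)
open Literature.AlgebraicGeometry.AbelianSchemes.AbelianSchemeOver (fibreHom)
open Literature.Geometry.ComplexAnalytic (totalOver)
open Literature.Geometry.Kaehler (ComplexTorus)
open Literature.Geometry.Kaehler.ComplexTorus (cover)
open scoped MonObj

namespace SiegelAdelicMarking

variable {g : ℕ} {δ : Fin g → ℕ} {J : C0pm δ} {a : gspFinAdelic δ}

/-- **THE ENDOMORPHISM OF A CHART RECIPE READS THE INTEGRAL MATRIX THROUGH THE MARKING.**  `B → T` an abelian scheme over a complex base `T`, `s` a complex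
point, `m` a marking of `B_s` whose torus map read in the total space is the chart fibre map `e` (`hm`, the last (ADM) conjunct of ★ P-3 ∕ ★ COV-6),
`Y : B → B` a homomorphism with the chart recipe `φA (e (C z)) = φA (e z) ≫ Y` (`hY`, ★ COV-6's last clause) for the avatar `C` of the integral matrix `A` in the
marking's complex coordinates (`hC`).  Then `Y_s (m τ) = m (ρ(A) τ)` on the model torus — the `Reads`-clause of the E6 closer at the fibre `B_s`.
[cite: BirkenhakeLange2004, §1.2 Proposition 1.2.1 and (1.2)] [cite: MumfordFogartyKirwan1994, Ch. 6 §2 Definition 6.3 (p. 120)]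
[cite: Milne2005ShimuraVarieties, §6 Thm. 6.11 pp. 74–75] -/
theorem map_fibreHom_toFun_eq_of_chartRecipe {T : SchemeOver ℂ} (B : AbelianSchemeOver T.left) {MA : Type*}
    (φA : MA → ComplexPoints (totalOver T B)) {s : Spec (.of ℂ) ⟶ T.left}
    (m : SiegelAdelicMarking J a (B.fibre s).toAbelianVariety) (e : (Fin g → ℂ) → MA)
    (hm : ∀ z : Fin g → ℂ, B.fibrePointToLeft s (m.toFun (cover m.Ψ z)) = (φA (e z)).left)
    (Y : B.X ⟶ B.X) [IsMonHom Y] (C : (Fin g → ℂ) → (Fin g → ℂ))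
    (hY : ∀ z : Fin g → ℂ, (φA (e (C z))).left = (φA (e z)).left ≫ Y.left)
    (A : Matrix (Fin g ⊕ Fin g) (Fin g ⊕ Fin g) ℤ) (hC : ∀ w : Fin g ⊕ Fin g → ℝ, C (m.Ψ w) = m.Ψ ((A.map (Int.cast : ℤ → ℝ)) *ᵥ w))
    (τ : ComplexTorus m.Ψ) :
    AlgPoints.map (fibreHom Y s).hom.hom.hom (m.toFun τ) = m.toFun (ComplexTorus.mapMatrix m.Ψ m.Ψ A τ) := by
  obtain ⟨z, rfl⟩ := ComplexTorus.cover_surjective m.Ψ τ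
  -- the avatar is the real representation of `A` in the coordinates `Ψ`
  have hCz : C z = ComplexTorus.realRep m.Ψ m.Ψ A z := by
    obtain ⟨w, rfl⟩ := m.Ψ.surjective z
    rw [hC w, ComplexTorus.realRep_apply]
  apply B.fibrePointToLeft_injective s
  rw [AbelianSchemeOver.fibrePointToLeft_map_fibreHom Y s, hm z, ComplexTorus.mapMatrix_cover, ← hCz, hm (C z)]
  exact (hY z).symm

end SiegelAdelicMarking

end Literature.AlgebraicGeometry.ModuliOfAbelianVarieties

end
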